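import Mathlib
import HarnessLib
import HarnessLib.Audit
import Summits.CriticalPhenomena.Statement
import Literature.Probability.Percolation.TwoPointFunction

/-!
Route: PercTreeValue

DORMANT since 2026-08-24T06:30:01Z (reconciler: no traction for 6.6 d (last activity item-evidence-added at 2026-08-17T16:01:04Z); parked, not closed — `ledger route dormant route-CriticalPhenomena-PercTreeValue --off` to reactivate) — unstaffed, not closed; items shared with open routes are served there. `ledger route dormant <id> --off` reactivates.

# Route PercTreeValue — the tree value — a jump makes ℤ³ pattern-blind at large scales; θ(p_c)=0
from any one connection-pattern amplitude of the critical tetrahedron off its jump value (d*≈0.15,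
H*≈1.46, R*²≈1.11, Φ₄*≈1.18)

It suffices to show X = "one balanced connection-pattern amplitude of the critical lattice
tetrahedron misses its jump value"
(card CriticalPhenomena/PercolationContinuityZ3/tree-value-factorisation, sharpened). Geometry: T_r
= {0, a_r, b_r, c_r} ⊂ ℤ³,
a_r = (r,r,0), b_r = (r,0,r), c_r = (0,r,r) (regular: all six edges of Euclidean length r√2; faces
equilateral; opposite edges {0,a_r},
{b_r,c_r} lie in the planes x₂ = 0, x₂ = r). With P = P_{p_c(ℤ³)}, τ = two-point function at p_c,
the JUMP-SIDE LEMMA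
(support ConnectionPatternFactorisation, provable now): if θ(p_c) = t* > 0 then for k mutually
distant points every probability
"these prescribed pairs are connected" tends to t*^k (k-fold mixing of the product measure for the
non-local events {x ∈ C_∞} +
uniqueness + finiteness of off-C_∞ clusters), and every probability that also asks two of the points
to be DISconnected tends to 0.
Hence a jump pins, as r → ∞: d_r := P(0↔a_r, b_r↔c_r, 0↮b_r)/(τ(0,a_r)τ(b_r,c_r)) → 0; H_r :=
P(0↔a_r ∧ b_r↔c_r)/(τ(0,a_r)τ(b_r,c_r)) → 1;
R_r² := P(0↔a_r↔b_r)²/(τ(0,a_r)τ(a_r,b_r)τ(b_r,0)) → 1; Φ_r :=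
P(0↔a_r↔b_r↔c_r)·τ(0,a_r)/(P(0↔a_r↔b_r)·P(0↔a_r↔c_r)) → 1
("the tree / factorisation values"). X is any one of the four cruxes below (each asserts one of
these ratios stays a fixed distance
from its jump value for all r ≥ r₀); the ASSEMBLY is a two-line contradiction. Pilot Monte Carlo
this seat (kit j000096 L=48, j000098 L=96,
all translates averaged, data collapse in r/L): d* ≈ 0.15, H* ≈ 1.46, R*² ≈ 1.11 (R* ≈ 1.05), Φ₄* ≈
1.18, finite-size drift only.
The spine used by the Assembly item is the Harris-gap form H (crux TetrahedronHarrisGap); the rank-2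
crux TetrahedronDisjointCoexistence
needs no mixing at all (support AssemblyViaDisjointCoexistence); the card's own F3- /F4 are cruxes
EquilateralAntiFactorisation /
TetrahedronLogConvexity with support assemblies.
Lean: `∃ δ : ℝ, 0 < δ ∧ ∃ r₀ : ℕ, ∀ r : ℕ, r₀ ≤ r → (1 + δ) * Literature.Probability.Percolation.tau
3 (Literature.Probability.Percolation.criticalProbI 3) 0 ![(r : ℤ), (r : ℤ), 0] *
Literature.Probability.Percolation.tau 3 (Literature.Probability.Percolation.criticalProbI 3) ![(r :
ℤ), 0, (r : ℤ)] ![0, (r : ℤ), (r : ℤ)] ≤ (Literature.Probability.Percolation.bondPercolation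
(Literature.Probability.LatticeModels.zdGraph 3) (Literature.Probability.Percolation.criticalProbI
3)).real (Literature.Probability.Percolation.openConn 0 ![(r : ℤ), (r : ℤ), 0] ∩
Literature.Probability.Percolation.openConn ![(r : ℤ), 0, (r : ℤ)] ![0, (r : ℤ), (r : ℤ)])`

## Assembly
Pure limit bookkeeping once ConnectionPatternFactorisation is a theorem: assume θ := theta (zdGraph
3) 0 (criticalProbI 3) ≠ 0, so θ > 0;
apply the factorisation lemma at p = criticalProbI 3 with k = 4, E = {(0,1),(2,3)}, A_n = (0, a_n,
b_n, c_n) (pairwise sup-distances = n → ∞)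
to get P(0↔a_n ∧ b_n↔c_n) → θ⁴, and with k = 2, E = {(0,1)} to get τ(0,a_n) → θ², τ(b_n,c_n) → θ²;
`le_of_tendsto_of_tendsto` on the crux
inequality gives (1+δ)θ⁴ ≤ θ⁴, contradicting δ > 0, θ > 0. Hence θ = 0, which is
PercolationContinuityZ3 by `Iff.rfl`. The three sibling
assemblies are filed as support items so that ANY of the four cruxes closes the conjunct.

Rationale: WHY THIS LINE. Mechanism (card tree-value-factorisation; Gladkov2024 §6.3 p.10 prints the k=3
supercritical saturation "θ⁶ ≤ 8θ⁶" without the converse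
programme; Hutchcroft2025 Thm II.1.11/Rem II.1.12 treats k-point functions only up to constants): a
first-order critical point on the
amenable lattice ℤ³ is PATTERN-BLIND at large scales — all k-point connection-pattern probabilities
factorise to powers of θ — so the
order of the transition is read off a dimensionless, scale-free AMPLITUDE compared with the constant
1 (or 0), never off a decay rate;
every τ-route in the sub (PercTwoPointDecay, PercHyperscalingGluing, PercAnnulusCrossing …) needs a
rate or a crossing bound, and the
tree's criterion θ(p_c)=0 ⟺ τ→0 (`theta_eq_zero_iff_tendsto_tau_cofinite`) shows why unbalanced
statements are restatements.
This seat's sharpening of the card: (i) ∃-family and degenerate-shape versions of 4-point amplitude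
cruxes are TRIVIAL restatements
(Harris + τ→0 on slowly separating families), and thin/elongated shapes leverage relative decay
between internal scales, so all cruxes
are pinned to ONE rigid geometry, the regular lattice tetrahedron, uniformly in r; (ii) besides the
card's R (Delfino–Viti/Gladkov
ratio, doi:10.1088/1751-8113/44/3/032001, Gladkov2024 Thm 1.1) and Φ₄ (size bias) we file the two
opposite-edge pattern amplitudes:
the Harris ratio H (jump value 1, reality 1.46) and the disjoint-coexistence ratio d (jump value 0
by uniqueness alone, reality 0.15,
so ANY δ > 0 suffices — an up-to-constants reverse-BK statement, the one member of the family that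
is not a sharp-constant problem).
Imported area: universal amplitude ratios / OPE structure of critical k-point functions
(statistical-field-theory side: Delfino–Viti,
arXiv:1011.1101, arXiv:2107.01788 for d=2) turned into exponent-free percolation inequalities; the
engine literature is the
decision-tree/multi-copy inequality technology (Gladkov2024 Main Lemma 8.1, Thm 5.2; Hutchcroft2025
Thm II.3.1) and BK/reverse-BK.
Negatives index (1 SAW statement) untouched; no refuted statement is re-asked.

RANKED CRUXES. #2 TetrahedronDisjointCoexistence (crux) — DISJOINT COEXISTENCE (reverse BK up to a
constant for the two opposite edges of T_r): ∃ δ > 0, r₀ such that for all r ≥ r₀, P_{p_c}(0 ↔ a_r,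
b_r ↔ c_r, 0 ↮ b_r) ≥ δ · τ(0,a_r) · τ(b_r,c_r) — two interleaved macroscopic connections are
realised by two DIFFERENT clusters at a rate comparable to independence (BK gives ≤ 1·ττ). Jump
value 0 (uniqueness: two far connected pairs in distinct clusters force a finite cluster of diameter
≥ r); pilot MC d* ≈ 0.15 (d_r = 0.147(3), 0.142(4), 0.130(7) at r = 6, 8, 12, L = 96). The only crux
of the family that is an up-to-constants statement. [difficulty: open-problem] (why it might fail:
MC: d*≈0.15, i.e. only 10% of doubly-connected configurations are disjoint (merging dominates);
lower-bounding a disjoint-occurrence probability is reverse-BK — no tool in d=3 (in d=2: RSW + arm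
separation); it must fail in every jump world and for d>6 (d→0 there too).) [Grimmett1999,
BurtonKeane1989, Aizenman1997, BorgsChayesKestenSpencer1999, DuminilCopinSidoraviciusTassion2016,
Cerf2015, Gladkov2024]
#3 TetrahedronHarrisGap (crux) — STRICT HARRIS for the opposite edges: ∃ δ > 0, r₀: ∀ r ≥ r₀,
P_{p_c}(0 ↔ a_r ∧ b_r ↔ c_r) ≥ (1+δ) τ(0,a_r) τ(b_r,c_r). Harris gives ≥ 1·ττ on every graph; a jump
forces the ratio → 1 exactly (asymptotic independence of macroscopic connection events = asymptotic
Harris EQUALITY); pilot MC H* ≈ 1.46 (H_r = 1.448(6), 1.433(9), 1.419(16) at r = 6, 8, 12, L = 96).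
Exact identity H = Ψ + d with Ψ := τ₄/ττ (MC 1.30) and d of the rank-2 crux, so this crux is implied
by "τ₄ ≥ (1+δ)ττ" and is the weakest amplitude statement of the family. The Assembly item runs
through this crux. [difficulty: open-problem] (why it might fail: Needs a constant: H*≈1.46 (pilot
MC, r/L→0) vs jump value 1; Harris gives only ≥1 and any all-graph inequality is saturated by
factorising worlds; the natural proof (hook-on gain of y,z onto C(0,a)) leans on relative one-arm
decay between scales, i.e. continuity-strength input.) [Harris1960, Grimmett1999, Gladkov2024,
Hutchcroft2025, arXiv:1011.1101]
#4 EquilateralAntiFactorisation (crux) — the card's F3- on the equilateral face {0, a_r, b_r}: ∃ δ >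
0, r₀: ∀ r ≥ r₀, P_{p_c}(0 ↔ a_r ↔ b_r)² ≥ (1+δ) τ(0,a_r) τ(a_r,b_r) τ(b_r,0), i.e. the
Gladkov/Delfino–Viti ratio R = τ₃/(τττ)^{1/2} stays ≥ (1+δ)^{1/2} (Gladkov2024 Thm 1.1: R ≤ √8 on
every graph; trees: R ≡ 1; jump: R → 1; d>6: R → 0; d=2: R* = 1.022; pilot MC ℤ³: R* ≈ 1.05, R*² =
1.103(4), 1.104(7), 1.108(12) at r = 6, 8, 12, L = 96). "Is the percolation OPE coefficient C_σσσ of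
ℤ³ larger than 1?" — pure amplitude, no internal scale ratio; the soft Harris bound saturates at
τ(a)² < 1 even on degenerate families, so no ∃-family loophole. [difficulty: open-problem] (why it
might fail: Sharp constant with an 11% margin (R*²≈1.11 pilot MC); the 2D analogue R*=1.022 is
proved only through CLE/imaginary-DOZZ (arXiv:2107.01788) — no soft proof of R*>1 exists in any
dimension; HK gives only R² ≥ τ → 0; R* could still creep to 1 beyond r=24.) [Gladkov2024,
Hutchcroft2025, doi:10.1088/1751-8113/44/3/032001, arXiv:1011.1101, arXiv:2107.01788,
arXiv:2510.05850]
#5 TetrahedronLogConvexity (crux) — the card's F4 (size bias / strict log-convexity in the number of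
points): ∃ δ > 0, r₀: ∀ r ≥ r₀, P(0↔a_r↔b_r↔c_r) · τ(0,a_r) ≥ (1+δ) · P(0↔a_r↔b_r) · P(0↔a_r↔c_r),
i.e. P(c_r joins | 0,a_r,b_r joined) ≥ (1+δ) P(c_r joins | 0,a_r joined): capturing a far point is
easier for a cluster already known to capture more far points (broad conditional mass law) — false
exactly when the conditional mass is degenerate (jump: Φ → 1). Pilot MC Φ₄* ≈ 1.18 (1.179(4),
1.169(5), 1.163(8) at r = 6, 8, 12, L = 96). [difficulty: open-problem] (why it might fail:
Constant-level (Φ4*≈1.18, pilot MC); conditioning on a larger joined set is not a monotone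
conditioning, so FKG is silent; bunkbed-type monotonicity is false on general graphs
(GladkovPakZimin2024), so the proof must use ℤ³ at large scales; no engine yet.) [Gladkov2024,
GladkovPakZimin2024, Hutchcroft2025, AizenmanNewman1984]
#9 ConnectionPatternFactorisation (support) — JUMP ⟹ PATTERN-BLINDNESS, stated unconditionally at
every p (the card's T1, generalised): for every p, every k and every pattern E ⊆ Fin k × Fin k of
prescribed connections without loops that mentions every index, and every sequence of k-point
configurations A_n in ℤ³ whose pairwise sup-distances all tend to ∞, P_p(⋂_{(i,j)∈E} {A_n i ↔ A_n
j}) → θ(p)^k. Proof sketch (all inputs in the tree): if θ(p) = 0 the event lies inside one {A_n i ↔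
A_n j} whose probability → 0 (`theta_eq_zero_iff_tendsto_tau_cofinite` + `tau_eq_tau_zero_sub`); if
θ(p) > 0: lower bound P(all k points ∈ C_∞) → θ^k by k-fold mixing of the product measure
(approximate {0 ∈ C_∞} by a local event, `exists_isLocalEvent_measure_symmDiff_lt`, independence of
local events on disjoint edge sets, shift invariance `bondPercolation_real_preimage_shift`) and
uniqueness `Grimmett1999_numInfiniteClusters_le_one_holds` (all in C_∞ ⟹ all connected); upper bound
by the same mixing plus P(x ↔ y, |C(x)| < ∞) ≤ P(‖x−y‖ ≤ |C(0)| < ∞) → 0. Shared with sibling card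
no-self-averaging-cauchy-schwarz (its L1). [difficulty: provable-now] [Grimmett1999,
BurtonKeane1989, AizenmanDuminilCopinSidoravicius2015, Gladkov2024]
#9 AssemblyViaDisjointCoexistence (support) — TetrahedronDisjointCoexistence →
PercolationContinuityZ3, with NO mixing: if θ := θ(p_c) > 0 then τ ≥ θ²
(`Grimmett1999_theta_sq_le_openConn_holds`) makes the left side ≥ δθ⁴ > 0 for all r ≥ r₀, while the
event {0↔a_r, b_r↔c_r, 0↮b_r} is contained in {0↔a_r, |C(0)|<∞} ∪ {b_r↔c_r, |C(b_r)|<∞} ∪ {two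
infinite clusters}; the last is null by `Grimmett1999_numInfiniteClusters_le_one_holds`, the first
two have probability ≤ P(2r+1 ≤ |C(0)| < ∞) → 0 (shift invariance for the second; continuity from
above of the measure). Contradiction, so θ(p_c) = 0. [difficulty: provable-now] [Grimmett1999,
BurtonKeane1989]
#9 AssemblyViaThreePoint (support) — ConnectionPatternFactorisation → EquilateralAntiFactorisation →
PercolationContinuityZ3 (the card's spine assembly): if θ(p_c) > 0, the pattern {(0,1),(0,2)} on A_n
= (0, a_n, b_n) gives P(0↔a_n↔b_n) → θ³ and the pattern {(0,1)} on pairs gives each τ → θ²; passing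
to the limit in (1+δ)τττ ≤ τ₃² yields (1+δ)θ⁶ ≤ θ⁶, absurd. Bookkeeping: ⋂ over the two-element
Finset = openConn ∩ openConn; pairwise distances of T_r are r in sup norm. [difficulty:
provable-now] [Gladkov2024, Grimmett1999]
#9 AssemblyViaLogConvexity (support) — ConnectionPatternFactorisation → TetrahedronLogConvexity →
PercolationContinuityZ3: same two-line limit argument ((1+δ)θ³θ³ ≤ θ⁴θ²). [difficulty: provable-now]
[Gladkov2024, Grimmett1999]

TWO-LAYER PLAN. Foreseen glued splits (nothing filed now). TetrahedronDisjointCoexistence ⇐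
SlabRestrictionCost → InterfaceBlocking → TetrahedronDisjointCoexistence,
where SlabRestrictionCost: τ^{U}(0,a_r) ≥ c₁ τ(0,a_r) for U = {x₂ ≤ r/3} (connections at scale r do
not need the far half-space; a
receding-floor statement of BGN type, cf. cards climb-ratio-receding-floor-v2,
beta-s-halfspace-linear-onset) and InterfaceBlocking: given
independent restricted clusters K₁ ∋ 0,a_r in U and K₂ ∋ b_r,c_r in V = {x₂ ≥ 2r/3}, P(no open path
of ω joins K₁ to K₂) ≥ c₂ (a blocking
statement relative to GIVEN sparse sets, weaker than annulus RSW; glue = independence of the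
disjoint slabs, exact). TetrahedronHarrisGap ⇐
FourPointExcess (τ₄ ≥ (1+δ)ττ, i.e. Ψ* ≈ 1.30 > 1) → TetrahedronHarrisGap (glue: H = Ψ + d ≥ Ψ, one
line); or ⇐ HookOnGain: P(b_r, c_r ∈ C(0) |
0 ↔ a_r) ≥ (1+δ)^{1/2}·P(0 ↔ ∂B_{r/2})·(BK constant) twice → TetrahedronHarrisGap (glue: BK upper
bound τ(b,c) ≤ π(r/2)², in tree as
`tau_le_real_siteToBoundary`-type facts). EquilateralAntiFactorisation ⇐ a strict-remainder version
of Gladkov's two-copy exploration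
(Gladkov2024 Thm 5.2 / Remark 6.3 give remainders in the UPPER direction only) — no typable child
yet.

KILL CRITERIA. Certified numerics (larger L, r ≤ L/8, several seeds) showing an amplitude converging
to its jump value — d_r → 0, H_r → 1, R_r → 1 or
Φ_r → 1 as r/L → 0 — retires THAT crux (close it `refuted:` with the evidence file); all four
drifting to their jump values closes the route
`refuted:TetrahedronHarrisGap` (the line is "amplitudes separate the worlds"). A proof that every
decision-tree/HK/vdBK-derivable k-point
inequality valid on all graphs is saturated by factorising (tree / Aizenman–Newman / wired-RC)
worlds in BOTH directions does not refute a
crux but leaves the sharp-constant cruxes (ranks 3–5) engine-less: pivot the route to the rank-2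
crux and its split (restriction + blocking).
A refutation of ConnectionPatternFactorisation is impossible short of an inconsistency (it is a
theorem of the jump world and of the
continuous world alike) — a bounce there means a mis-typed signature, to be restated 1:1. Proved
elsewhere: any proof of the conjunct moots
the assemblies; the amplitudes d*, H*, R*, Φ₄* of ℤ³ keep independent value (first measurements:
this route's mc/results.md).

NOT DECOMPOSED YET. Which exploration/coupling produces a strict remainder in the LOWER direction
(Gladkov's machinery gives upper bounds: R ≤ √8, Hutchcroft2025
Thm II.3.1 for k points); whether to work with Gladkov's three-cluster variables P(ab|c), P(a|b|c)
(his Conj 10.1, p.18) instead of τ's;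
the thin-rectangle / collinear (OPE) regimes (deliberately EXCLUDED: their margins are relative
decay in disguise, and their ∃-family forms
are trivial restatements via Harris + τ→0); the sub-unit Gladkov direction R ≤ ρ < 1 (numerically
dead on ℤ³: R* ≈ 1.05 > 1; alive near
d = 6 where C_σσσ = O(√ε), a d = 5 project, not this route); box-averaged moment ratios (sibling
card no-self-averaging-cauchy-schwarz);
constants δ, r₀ existential throughout; no rates anywhere.

CHEAPEST FALSIFIER. RUN this seat: pilot Monte Carlo of all four amplitudes on the periodic torus at
p = 0.2488126 (kit j000096: L=48, 300 samples, r=4..12;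
j000098: L=96, 120 samples, r=6..24; script mc/tetra_mc.py, union-find via scipy connected
components, every translate averaged, jackknife):
d = 0.147(3)/0.142(4)/0.130(7), H = 1.448(6)/1.433(9)/1.419(16), R² = 1.103(4)/1.104(7)/1.108(12),
Φ₄ = 1.179(4)/1.169(5)/1.163(8) at
r = 6/8/12 (L=96); the drift toward the jump values at larger r is a pure r/L (wrap-around) effect —
L=48 and L=96 collapse at equal r/L
(r/L=1/4: H = 1.295 vs 1.311; 1/8: 1.437 vs 1.419) — so no amplitude is within reach of its jump
value. Next cheapest (refuter): L=144/192,
r ≤ L/8, 3 seeds, fit A(r,L) = A* + c·(r/L)^ω (job j000129 L=144 submitted by this seat); and the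
lookup "is a 3D three-point amplitude
R* in print?" (zbMATH/galaxy: no; Gori–Trombettoni arXiv:1504.07209 measure only two-point functions
in bounded 3D geometries).

NUMBERS. p_c(ℤ³, bond) = 0.2488126(5); 2Δ = d−2+η = 0.954 (η = −0.046), so τ(r)/τ(2r) → 2^{0.954} =
1.94 in the continuous world vs 1 in a jump
world (measured 1.88 at r/L = 1/16, rising) — recorded as a diagnostic only: the uniform
doubling-ratio statement is a decay statement and
trivially implies the conjunct, hence is NOT a crux. Jump values: d = 0, H = Ψ = R = Φ₄ = 1.
Measured (r/L → 0 plateau, L = 96): d* ≈ 0.15,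
H* ≈ 1.46, Ψ* = τ₄/ττ ≈ 1.30 (identity H = Ψ + d checked to 3 digits), R* ≈ 1.05 (R*² ≈ 1.11; card's
pilot 1.04–1.08 at L ≤ 48), Φ₄* ≈ 1.18
(identity Ψ = Φ₄R² checked). Conditional reading: given both opposite edges connected, the two
clusters coincide with probability
Ψ/H ≈ 0.90 and differ with probability d/H ≈ 0.10 (jump world: 1 and 0). Other dimensions: d = 2: R*
= 1.0220 (Delfino–Viti, proved via CLE,
arXiv:2107.01788), half-plane boundary 1.02992 (Gladkov2024 §6.3); d > 6: R → 0, H → 1⁺ like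
r^{4−d}·(mean-field diagrams), d → 0;
Gladkov's universal bound R ≤ 2√2. Items at open: 9 (4 cruxes, 4 support, 1 assembly).

DEFINITION REQUESTS. None. k-point events are written as finite intersections of `openConn`; the
pattern lemma uses `⋂ e ∈ E` over a `Finset (Fin k × Fin k)`;
sites of T_r are `![r, r, 0]` etc. (Mathlib vector notation, `Site 3 = Fin 3 → ℤ`); `tau` from
Literature.Probability.Percolation.TwoPointFunction
(listed in imports). Cite facts wanted later (not blocking): Gladkov2024 Thm 6.2 (τ(abc)² ≤ 8τττ on
every graph) and Hutchcroft2025 Thm II.3.1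
as Literature named facts (upper-direction context for ranks 3–5); bib entries DelfinoViti2010 /
ZiffSimmonsKleban2011 prepared in this
folder (refs.bib) — `ledger bib add` returned "empty response from gate" twice this seat; cited by
DOI/arXiv id meanwhile.

Novelty: Searches (2026-08-15; searchd rc 75, OpenAlex/S2/arXiv HTTP 429 all session, so zbMATH + galaxy +
reading): zbMATH "three-point connectivity percolation" (4: doi:10.1088/1751-8113/44/3/032001,
arXiv:1304.6511, Hara–Slade IIC, arXiv:2510.05850 2D Potts three-point constant), "factorization
correlations percolation" (arXiv:1011.1101), "k-point function percolation" (arXiv:2607.22387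
Blanc-Renaudie–Hutchcroft high-d super-Brownian k-point, arXiv:2508.18808), "three-point function
percolation" (7, all 2D/CFT or high-d), "conformal invariance three-dimensional percolation"
(arXiv:1504.07209, two-point only), "structure constant percolation three dimensions" /
"connectivity amplitude ratio percolation" (0 relevant); `lit galaxy search "three-point
connectivity" --star all` (10: 2D theses, Manna–Ziff 2003.09590, Hutchcroft I 2508.18807,
He–Jacobsen–Saleur JHEP 2020 geometric 4-point functions of 2D Potts), "Delfino-Viti" pdf (0),
"three-point connectivities" all (0); `lit frontier CriticalPhenomena --since 2023` (30 rows: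
arXiv:2605.30299 reverse Simon–Lieb in high d; nothing on 3D k-point amplitudes); `lit bridges
CriticalPhenomena --cross any` (none relevant); read Gladkov2024 pp.2, 8–10, 18–19 (Thm 1.1/6.2,
§6.3, Conj 10.1) and Hutchcroft2025 pp.12–13, 23, 53 (Thm II.1.11, Rem II.1.12, Thm II.3.1, Thm
II.5.10); all 25 Theses of the sub grep'd (Gladkov appears only in PercNearOneGluing, for near-one
gluing); the card's novelty audit (new-combination) and the sibling card.
Nearest  [refs: 10.1088/1751-8113/44/3/032001, 1304.6511, 2510.05850, 1011.1101, 2607.22387, 2508.18808, 1504.07209, 2605.30299, 2107.01788, doi:10.1088/1751-8113/44/3/032001, Gladkov2024, Hutchcroft2025]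

Barriers (technique_class: k-point-amplitude, pattern-blindness, reverse-BK): - technique_class: k-point-amplitude, pattern-blindness, reverse-BK
- Literature.Barriers.CriticalPhenomena.TreesPercolatingAtCriticality: on trees R ≡ Φ₄ ≡ 1
identically (Steiner-edge double count) and uniqueness fails, so neither the cruxes' constants nor
the assemblies survive there — as required: every assembly uses amenability through
`Grimmett1999_numInfiniteClusters_le_one_holds` / τ ≥ θ², and every crux constant must come from ℤ³
geometry at large scales; no all-graph inequality (Gladkov's class) can deliver a constant on the
far side of the tree value, which is why the cruxes are ℤ³-only statements.
- Literature.Barriers.CriticalPhenomena.LongRangeDiscontinuity: the Aizenman–Newman 1/r² jump world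
factorises (d → 0, H, R, Φ₄ → 1 by mixing of its ordered phase), so all four cruxes are false there,
exactly as a lattice-specific crux must be; nothing range-blind is claimed.
- Literature.Barriers.CriticalPhenomena.RandomClusterFirstOrder: the wired q > Q transition has
long-range order and factorising k-point functions — same verdict: the cruxes fail there by design;
the jump-side lemma is the q = 1 (Bernoulli, independent) computation and uses independence (mixing
of the product measure) essentially.
- Literature.Barriers.CriticalPhenomena.SpanningClustersAboveSix: consistent and calibrating — for d
> 6 the amplitudes sit on the OTHER side (R → 0, d → 0, H → 1⁺ as r^{4−d}) while θ(p_c) = 0; the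
cruxes are false there and are not needed there; any proof must therefore us

Novelty grade: new-combination — route-review+novelty (refuter 2026-08-15). new-combination, as filed. Known: amplitude ratios of critical k-point connectivities (Delfino–Viti R=1.022 in 2D, proved arXiv:2107.01788; Gladkov2024 R≤2√2 + supercritical saturation §6.3; Hutchcroft2025 Thm II.1.11) and jump-side pattern blindness (local (refuter refuter-rreview-route-MatrixMultiplicati-fbd7c3e5-0, 2026-08-15T13:39:57Z; prior: Gladkov2024,Hutchcroft2025,DelfinoViti2010 doi:10.1088/1751-8113/44/3/032001,arXiv:2107.01788,arXiv:1011.1101,Grimmett1999,BurtonKeane1989,TanCouvreurDengJacobsen2019 arXiv:1809.06650)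

History (route lifecycle, newest last):
- 2026-08-17T01:04:19Z · skeleton.hides-summit: stub_certificate (stmt-CriticalPhenomena-7801) ⟷ summit (accepted theorem in Summits/CriticalPhenomena/PercolationContinuityZ3/Theorems/PercTreeValueTetrahedronLogConvexityCertStrength.lean) (prover-line-stmt-CriticalPhenomena-7801-c1-0)
- 2026-08-24T06:30:01Z · DORMANT — reconciler: no traction for 6.6 d (last activity item-evidence-added at 2026-08-17T16:01:04Z); parked, not closed — `ledger route dormant route-CriticalPhenomen (operator:999:3706105)

sub-problem: PercolationContinuityZ3 · status: dormant · opened planner-plancard-CriticalPhenomena-Percolatio-825a89c1-0 2026-08-15T12:18:47Z · rev 2 · ledger route-CriticalPhenomena-PercTreeValue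
GENERATED by the gate from the ledger (D-0016/17). Provers cite these decls: `theorem foo : Summit.CriticalPhenomena.PercolationContinuityZ3.Theses.PercTreeValue.<Decl> := …` in Summits/CriticalPhenomena/PercolationContinuityZ3/Theorems/<Name>.lean.
-/

namespace Summit.CriticalPhenomena.PercolationContinuityZ3.Theses.PercTreeValue

open scoped BigOperators Topology Manifold Classical MeasureTheory ProbabilityTheory Matrix InnerProductSpace ComplexConjugate ContinuousMap
open Filter Set Function TopologicalSpace MeasureTheory

attribute [summit_statement] _root_.PercolationContinuityZ3

/-- item stmt-CriticalPhenomena-7798 · crux · rank 2 · open · by planner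
why it might fail: Reverse BK up to a constant: no tool lower-bounds a two-distinct-cluster probability in d=3 (2D: RSW + arm separation; tree has only BK ⇒ δ≤1); MC d_r = 0.147→0.130 (r=6→12, L=96) drifts down — a two-cluster repulsion d_r ~ r^(-ζ) would kill it with θ(p_c)=0 intact; false in every jump world.
sources: Grimmett1999, vandenBergKestenJAP1985, BurtonKeane1989, Aizenman1997, BorgsChayesKestenSpencer1999, Kesten1987Scaling
[crux] DISJOINT COEXISTENCE (reverse BK up to a constant for the two opposite edges of T_r): ∃ δ >
0, r₀ such that for all r ≥ r₀, P_{p_c}(0 ↔ a_r, b_r ↔ c_r, 0 ↮ b_r) ≥ δ · τ(0,a_r) · τ(b_r,c_r) —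
two interleaved macroscopic connections are realised by two DIFFERENT clusters at a rate comparable
to independence (BK gives ≤ 1·ττ). Jump value 0 (uniqueness: two far connected pairs in distinct
clusters force a finite cluster of diameter ≥ r); pilot MC d* ≈ 0.15 (d_r = 0.147(3), 0.142(4),
0.130(7) at r = 6, 8, 12, L = 96). The only crux of the family that is an up-to-constants statement.
[difficulty: open-problem] -/
@[route_item "route-CriticalPhenomena-PercTreeValue"]
def TetrahedronDisjointCoexistence : Prop :=
  ∃ δ : ℝ, 0 < δ ∧ ∃ r₀ : ℕ, ∀ r : ℕ, r₀ ≤ r → δ * Literature.Probability.Percolation.tau 3 (Literature.Probability.Percolation.criticalProbI 3) 0 ![(r : ℤ), (r : ℤ), 0] * Literature.Probability.Percolation.tau 3 (Literature.Probability.Percolation.criticalProbI 3) ![(r : ℤ), 0, (r : ℤ)] ![0, (r : ℤ), (r : ℤ)] ≤ (Literature.Probability.Percolation.bondPercolation (Literature.Probability.LatticeModels.zdGraph 3) (Literature.Probability.Percolation.criticalProbI 3)).real (Literature.Probability.Percolation.openConn 0 ![(r : ℤ), (r : ℤ), 0] ∩ Literature.Probability.Percolation.openConn ![(r : ℤ),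 0, (r : ℤ)] ![0, (r : ℤ), (r : ℤ)] ∩ (Literature.Probability.Percolation.openConn (0 : Literature.Probability.LatticeModels.Site 3) ![(r : ℤ), 0, (r : ℤ)])ᶜ)

/-- item stmt-CriticalPhenomena-7799 · crux · rank 3 · open · by planner
why it might fail: Constant-level: Harris gives only δ=0 (every graph) and all-graph inequalities are saturated by factorising worlds, so δ>0 needs ℤ³ large-scale input (shared-pivotal mass of {0↔a},{b↔c} ≍ ττ) — no engine; H→1 for d>6 too (θ(p_c)=0 there): continuity does not force it; MC H*≈1.46 at L≤96, r≤12 only.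
sources: Harris1960, Grimmett1999, Aizenman1997, Gladkov2024, Hutchcroft2025, arXiv:1011.1101
[crux] STRICT HARRIS for the opposite edges: ∃ δ > 0, r₀: ∀ r ≥ r₀, P_{p_c}(0 ↔ a_r ∧ b_r ↔ c_r) ≥
(1+δ) τ(0,a_r) τ(b_r,c_r). Harris gives ≥ 1·ττ on every graph; a jump forces the ratio → 1 exactly
(asymptotic independence of macroscopic connection events = asymptotic Harris EQUALITY); pilot MC H*
≈ 1.46 (H_r = 1.448(6), 1.433(9), 1.419(16) at r = 6, 8, 12, L = 96). Exact identity H = Ψ + d with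
Ψ := τ₄/ττ (MC 1.30) and d of the rank-2 crux, so this crux is implied by "τ₄ ≥ (1+δ)ττ" and is the
weakest amplitude statement of the family. The Assembly item runs through this crux. [difficulty:
open-problem] -/
@[route_item "route-CriticalPhenomena-PercTreeValue"]
def TetrahedronHarrisGap : Prop :=
  ∃ δ : ℝ, 0 < δ ∧ ∃ r₀ : ℕ, ∀ r : ℕ, r₀ ≤ r → (1 + δ) * Literature.Probability.Percolation.tau 3 (Literature.Probability.Percolation.criticalProbI 3) 0 ![(r : ℤ), (r : ℤ), 0] * Literature.Probability.Percolation.tau 3 (Literature.Probability.Percolation.criticalProbI 3) ![(r : ℤ), 0, (r : ℤ)] ![0, (r : ℤ), (r : ℤ)] ≤ (Literature.Probability.Percolation.bondPercolation (Literature.Probability.LatticeModels.zdGraph 3) (Literature.Probability.Percolation.criticalProbI 3)).real (Literature.Probability.Percolation.openConn 0 ![(r : ℤ), (r : ℤ), 0] ∩ Literature.Probability.Percolation.openConn ![(r : ℤ), 0, (r : ℤ)] ![0, (r : ℤ), (r : ℤ)])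

/-- item stmt-CriticalPhenomena-7800 · crux · rank 4 · open · by planner
why it might fail: Sharp constant, 11% margin (R*²≈1.11, MC L≤96, r≤12): only the upper side is known (Gladkov2024 Thm 6.2, R²≤8 on every graph); 2D's R=1.022 needed CLE integrability (arXiv:2107.01788), no soft proof of R>1 in any d; R→0 for d>6 although θ(p_c)=0 there, so R*(ℤ³) may relax to ≤1 at r≫12.
sources: Gladkov2024, DelfinoViti2010, arXiv:2107.01788, arXiv:1011.1101, arXiv:2510.05850, Hutchcroft2025
[crux] the card's F3- on the equilateral face {0, a_r, b_r}: ∃ δ > 0, r₀: ∀ r ≥ r₀, P_{p_c}(0 ↔ a_r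
↔ b_r)² ≥ (1+δ) τ(0,a_r) τ(a_r,b_r) τ(b_r,0), i.e. the Gladkov/Delfino–Viti ratio R = τ₃/(τττ)^{1/2}
stays ≥ (1+δ)^{1/2} (Gladkov2024 Thm 1.1: R ≤ √8 on every graph; trees: R ≡ 1; jump: R → 1; d>6: R →
0; d=2: R* = 1.022; pilot MC ℤ³: R* ≈ 1.05, R*² = 1.103(4), 1.104(7), 1.108(12) at r = 6, 8, 12, L =
96). "Is the percolation OPE coefficient C_σσσ of ℤ³ larger than 1?" — pure amplitude, no internal
scale ratio; the soft Harris bound saturates at τ(a)² < 1 even on degenerate families, so no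
∃-family loophole. [difficulty: open-problem] -/
@[route_item "route-CriticalPhenomena-PercTreeValue"]
def EquilateralAntiFactorisation : Prop :=
  ∃ δ : ℝ, 0 < δ ∧ ∃ r₀ : ℕ, ∀ r : ℕ, r₀ ≤ r → (1 + δ) * Literature.Probability.Percolation.tau 3 (Literature.Probability.Percolation.criticalProbI 3) 0 ![(r : ℤ), (r : ℤ), 0] * Literature.Probability.Percolation.tau 3 (Literature.Probability.Percolation.criticalProbI 3) ![(r : ℤ), (r : ℤ), 0] ![(r : ℤ), 0, (r : ℤ)] * Literature.Probability.Percolation.tau 3 (Literature.Probability.Percolation.criticalProbI 3) ![(r : ℤ), 0, (r : ℤ)] 0 ≤ (Literature.Probability.Percolation.bondPercolation (Literature.Probability.LatticeModels.zdGraph 3) (Literature.Probability.Percolation.criticalProbI 3)).real (Literature.Probability.Percolation.openConn 0 ![(r : ℤ), (r : ℤ), 0] ∩ Literature.Probability.Percolation.openConn 0 ![(r : ℤ), 0, (r : ℤ)]) ^ 2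

/-- item stmt-CriticalPhenomena-7801 · crux · rank 5 · open · by planner
why it might fail: Constant-level (Φ₄*≈1.18, MC L≤96): even the δ=0 form P(0abc)·τ(0a) ≥ P(0ab)·P(0ac) is FALSE on general graphs (4-cycle 0-b-a-c-0, p<1/8: Φ₄≈8p<1; conditioning on {0↔a↔b} breaks FKG), so a proof must be ℤ³-at-large-scale specific; only upper tree-graph bounds exist; no engine.
sources: Gladkov2024, GladkovPakZimin2024, AizenmanNewman1984, Aizenman1997, Hutchcroft2025, Literature.Probability.Percolation.measure_openConn₄_le_tsum_tau
[crux] the card's F4 (size bias / strict log-convexity in the number of points): ∃ δ > 0, r₀: ∀ r ≥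
r₀, P(0↔a_r↔b_r↔c_r) · τ(0,a_r) ≥ (1+δ) · P(0↔a_r↔b_r) · P(0↔a_r↔c_r), i.e. P(c_r joins | 0,a_r,b_r
joined) ≥ (1+δ) P(c_r joins | 0,a_r joined): capturing a far point is easier for a cluster already
known to capture more far points (broad conditional mass law) — false exactly when the conditional
mass is degenerate (jump: Φ → 1). Pilot MC Φ₄* ≈ 1.18 (1.179(4), 1.169(5), 1.163(8) at r = 6, 8, 12,
L = 96). [difficulty: open-problem] -/
@[route_item "route-CriticalPhenomena-PercTreeValue"]
def TetrahedronLogConvexity : Prop :=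
  ∃ δ : ℝ, 0 < δ ∧ ∃ r₀ : ℕ, ∀ r : ℕ, r₀ ≤ r → (1 + δ) * (Literature.Probability.Percolation.bondPercolation (Literature.Probability.LatticeModels.zdGraph 3) (Literature.Probability.Percolation.criticalProbI 3)).real (Literature.Probability.Percolation.openConn 0 ![(r : ℤ), (r : ℤ), 0] ∩ Literature.Probability.Percolation.openConn 0 ![(r : ℤ), 0, (r : ℤ)]) * (Literature.Probability.Percolation.bondPercolation (Literature.Probability.LatticeModels.zdGraph 3) (Literature.Probability.Percolation.criticalProbI 3)).real (Literature.Probability.Percolation.openConn 0 ![(r : ℤ), (r : ℤ), 0] ∩ Literature.Probability.Percolation.openConn 0 ![0, (r : ℤ), (r : ℤ)]) ≤ (Literature.Probability.Percolation.bondPercolation (Literature.Probability.LatticeModels.zdGraph 3) (Literature.Probability.Percolation.criticalProbI 3)).real (Literature.Probability.Percolation.openConn 0 ![(r : ℤ), (r : ℤ), 0] ∩ Literature.Probability.Percolation.openConn 0 ![(r : ℤ), 0, (r : ℤ)] ∩ Literature.Probability.Percolation.openConn 0 ![0, (r : ℤ), (r : ℤ)]) * Literature.Probability.Percolation.tau 3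 (Literature.Probability.Percolation.criticalProbI 3) 0 ![(r : ℤ), (r : ℤ), 0]

/-- item stmt-CriticalPhenomena-7802 · support · rank 9 · closed · proved by Summit.CriticalPhenomena.PercolationContinuityZ3.Theorems.connectionPatternFactorisation_proof @ 46c82cbfd7c6 (prover) · by planner
sources: Grimmett1999, BurtonKeane1989, AizenmanDuminilCopinSidoravicius2015, Gladkov2024
[support] JUMP ⟹ PATTERN-BLINDNESS, stated unconditionally at every p (the card's T1, generalised):
for every p, every k and every pattern E ⊆ Fin k × Fin k of prescribed connections without loops
that mentions every index, and every sequence of k-point configurations A_n in ℤ³ whose pairwise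
sup-distances all tend to ∞, P_p(⋂_{(i,j)∈E} {A_n i ↔ A_n j}) → θ(p)^k. Proof sketch (all inputs in
the tree): if θ(p) = 0 the event lies inside one {A_n i ↔ A_n j} whose probability → 0
(`theta_eq_zero_iff_tendsto_tau_cofinite` + `tau_eq_tau_zero_sub`); if θ(p) > 0: lower bound P(all k
points ∈ C_∞) → θ^k by k-fold mixing of the product measure (approximate {0 ∈ C_∞} by a local event,
`exists_isLocalEvent_measure_symmDiff_lt`, independence of local events on disjoint edge sets, shift
invariance `bondPercolation_real_preimage_shift`) and uniqueness
`Grimmett1999_numInfiniteClusters_le_one_holds` (all in C_∞ ⟹ all connected); upper bound by the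
same mixing plus P(x ↔ y, |C(x)| < ∞) ≤ P(‖x−y‖ ≤ |C(0)| < ∞) → 0. Shared with sibling card
no-self-averaging-cauchy-schwarz (its L1). [difficulty: provable-now] -/
@[route_item "route-CriticalPhenomena-PercTreeValue"]
def ConnectionPatternFactorisation : Prop :=
  ∀ (p : unitInterval) (k : ℕ) (E : Finset (Fin k × Fin k)), (∀ e ∈ E, e.1 ≠ e.2) → (∀ i : Fin k, ∃ e ∈ E, e.1 = i ∨ e.2 = i) → ∀ A : ℕ → Fin k → Literature.Probability.LatticeModels.Site 3, (∀ i j : Fin k, i ≠ j → Filter.Tendsto (fun n => ‖A n i - A n j‖) Filter.atTop Filter.atTop) → Filter.Tendsto (fun n => (Literature.Probability.Percolation.bondPercolation (Literature.Probability.LatticeModels.zdGraph 3) p).real (⋂ e ∈ E, Literature.Probability.Percolation.openConn (A n e.1) (A n e.2))) Filter.atTop (nhds (Literature.Probability.Percolation.theta (Literature.Probability.LatticeModels.zdGraph 3) 0 p ^ k))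

/-- item stmt-CriticalPhenomena-7803 · support · rank 9 · closed · proved by Summit.CriticalPhenomena.PercolationContinuityZ3.Theorems.AssemblyViaDisjointCoexistence_proof (prover) · by planner
sources: Grimmett1999, BurtonKeane1989
[support] TetrahedronDisjointCoexistence → PercolationContinuityZ3, with NO mixing: if θ := θ(p_c) >
0 then τ ≥ θ² (`Grimmett1999_theta_sq_le_openConn_holds`) makes the left side ≥ δθ⁴ > 0 for all r ≥
r₀, while the event {0↔a_r, b_r↔c_r, 0↮b_r} is contained in {0↔a_r, |C(0)|<∞} ∪ {b_r↔c_r,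
|C(b_r)|<∞} ∪ {two infinite clusters}; the last is null by
`Grimmett1999_numInfiniteClusters_le_one_holds`, the first two have probability ≤ P(2r+1 ≤ |C(0)| <
∞) → 0 (shift invariance for the second; continuity from above of the measure). Contradiction, so
θ(p_c) = 0. [difficulty: provable-now] -/
@[route_item "route-CriticalPhenomena-PercTreeValue"]
def AssemblyViaDisjointCoexistence : Prop :=
  TetrahedronDisjointCoexistence → PercolationContinuityZ3

/-- item stmt-CriticalPhenomena-7804 · support · rank 9 · closed · proved by Summit.CriticalPhenomena.PercolationContinuityZ3.Theorems.assemblyViaThreePoint_proof @ 93199528ccef (prover) · by planner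
sources: Gladkov2024, Grimmett1999
[support] ConnectionPatternFactorisation → EquilateralAntiFactorisation → PercolationContinuityZ3
(the card's spine assembly): if θ(p_c) > 0, the pattern {(0,1),(0,2)} on A_n = (0, a_n, b_n) gives
P(0↔a_n↔b_n) → θ³ and the pattern {(0,1)} on pairs gives each τ → θ²; passing to the limit in
(1+δ)τττ ≤ τ₃² yields (1+δ)θ⁶ ≤ θ⁶, absurd. Bookkeeping: ⋂ over the two-element Finset = openConn ∩
openConn; pairwise distances of T_r are r in sup norm. [difficulty: provable-now] -/
@[route_item "route-CriticalPhenomena-PercTreeValue"]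
def AssemblyViaThreePoint : Prop :=
  ConnectionPatternFactorisation → EquilateralAntiFactorisation → PercolationContinuityZ3

/-- item stmt-CriticalPhenomena-7805 · support · rank 9 · closed · proved by Summit.CriticalPhenomena.PercolationContinuityZ3.Theorems.percTreeValue_assemblyViaLogConvexity_proof @ a572036fb3f5 (prover) · by planner
sources: Gladkov2024, Grimmett1999
[support] ConnectionPatternFactorisation → TetrahedronLogConvexity → PercolationContinuityZ3: same
two-line limit argument ((1+δ)θ³θ³ ≤ θ⁴θ²). [difficulty: provable-now] -/
@[route_item "route-CriticalPhenomena-PercTreeValue"]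
def AssemblyViaLogConvexity : Prop :=
  ConnectionPatternFactorisation → TetrahedronLogConvexity → PercolationContinuityZ3

/-- item stmt-CriticalPhenomena-7806 · assembly · rank 1 · closed · proved by Summit.CriticalPhenomena.PercolationContinuityZ3.Theorems.percTreeValue_assembly_proof @ a9434ad31991 (prover) · by planner
sources: Grimmett1999, Gladkov2024, Harris1960
[assembly] ConnectionPatternFactorisation → TetrahedronHarrisGap → PercolationContinuityZ3. -/
@[route_item "route-CriticalPhenomena-PercTreeValue"]
def Assembly : Prop :=
  ConnectionPatternFactorisation → TetrahedronHarrisGap → PercolationContinuityZ3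

/-! D-0027 §2.1 — DECIDING THEOREM (planner-authored via `route open/edit --closes-file`; by planner-rbadge-CriticalPhenomena-PercTreeValue-f97e9a10-g4-0 2026-08-15T16:22:31Z):
its hypotheses are this route's items and its conclusion the sub-problem Statement (glue_lint), and it elaborates with this file. -/

@[closes "route-CriticalPhenomena-PercTreeValue"] theorem closes (hF : ConnectionPatternFactorisation) (hH : TetrahedronHarrisGap) :
    _root_.PercolationContinuityZ3 := by
  classical
  refine Literature.Probability.Percolation.percolationContinuityZ3_iff.mpr ?_
  by_contra hne
  -- θ := θ(p_c) > 0 in the jump world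
  have hθnn : 0 ≤ Literature.Probability.Percolation.theta (Literature.Probability.LatticeModels.zdGraph 3)
      (0 : Literature.Probability.LatticeModels.Site 3) (Literature.Probability.Percolation.criticalProbI 3) := by
    unfold Literature.Probability.Percolation.theta
    exact measureReal_nonneg
  have hθpos : 0 < Literature.Probability.Percolation.theta (Literature.Probability.LatticeModels.zdGraph 3)
      (0 : Literature.Probability.LatticeModels.Site 3) (Literature.Probability.Percolation.criticalProbI 3) :=
    lt_of_le_of_ne hθnn (Ne.symm hne)
  -- coordinate lower bound ⇒ sup-norm distances tend to ∞
  have key : ∀ (l : Fin 3) (f : ℕ → Literature.Probability.LatticeModels.Site 3),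
      (∀ n : ℕ, ‖f n l‖ = (n : ℝ)) → Filter.Tendsto (fun n => ‖f n‖) Filter.atTop Filter.atTop := by
    intro l f hf
    refine Filter.tendsto_atTop_mono (fun n => ?_) tendsto_natCast_atTop_atTop
    rw [← hf n]
    exact norm_le_pi_norm (f n) l
  -- the tetrahedron T_n = (0, a_n, b_n, c_n) and the two opposite edges as 2-point configurations
  let A4 : ℕ → Fin 4 → Literature.Probability.LatticeModels.Site 3 := fun n =>
    ![(0 : Literature.Probability.LatticeModels.Site 3), ![(n : ℤ), (n : ℤ), 0], ![(n : ℤ), 0, (n : ℤ)], ![0, (n : ℤ), (n : ℤ)]]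
  let A2 : ℕ → Fin 2 → Literature.Probability.LatticeModels.Site 3 := fun n =>
    ![(0 : Literature.Probability.LatticeModels.Site 3), ![(n : ℤ), (n : ℤ), 0]]
  let B2 : ℕ → Fin 2 → Literature.Probability.LatticeModels.Site 3 := fun n =>
    ![![(n : ℤ), 0, (n : ℤ)], ![0, (n : ℤ), (n : ℤ)]]
  have hdist4 : ∀ i j : Fin 4, i ≠ j →
      Filter.Tendsto (fun n => ‖A4 n i - A4 n j‖) Filter.atTop Filter.atTop := by
    intro i j hij
    fin_cases i <;> fin_cases j <;> (first | exact absurd rfl hij | skip) <;>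
      first
        | (refine key 0 _ (fun n => ?_); simp [A4]; done)
        | (refine key 1 _ (fun n => ?_); simp [A4])
  have hdist2 : ∀ i j : Fin 2, i ≠ j →
      Filter.Tendsto (fun n => ‖A2 n i - A2 n j‖) Filter.atTop Filter.atTop := by
    intro i j hij
    fin_cases i <;> fin_cases j <;> (first | exact absurd rfl hij | skip) <;>
      (refine key 0 _ (fun n => ?_); simp [A2])
  have hdistB : ∀ i j : Fin 2, i ≠ j →
      Filter.Tendsto (fun n => ‖B2 n i - B2 n j‖) Filter.atTop Filter.atTop := by
    intro i j hij
    fin_cases i <;> fin_cases j <;> (first | exact absurd rfl hij | skip) <;>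
      (refine key 0 _ (fun n => ?_); simp [B2])
  -- pattern-blindness limits from ConnectionPatternFactorisation
  have hF' := hF
  unfold ConnectionPatternFactorisation at hF'
  have h4 := hF' (Literature.Probability.Percolation.criticalProbI 3) 4 {((0 : Fin 4), (1 : Fin 4)), (2, 3)}
    (by decide) (by decide) A4 hdist4
  have h2a := hF' (Literature.Probability.Percolation.criticalProbI 3) 2 {((0 : Fin 2), (1 : Fin 2))}
    (by decide) (by decide) A2 hdist2
  have h2b := hF' (Literature.Probability.Percolation.criticalProbI 3) 2 {((0 : Fin 2), (1 : Fin 2))}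
    (by decide) (by decide) B2 hdistB
  have hlim4 : Filter.Tendsto (fun r : ℕ =>
      (Literature.Probability.Percolation.bondPercolation (Literature.Probability.LatticeModels.zdGraph 3)
        (Literature.Probability.Percolation.criticalProbI 3)).real
        (Literature.Probability.Percolation.openConn 0 ![(r : ℤ), (r : ℤ), 0] ∩
          Literature.Probability.Percolation.openConn ![(r : ℤ), 0, (r : ℤ)] ![0, (r : ℤ), (r : ℤ)]))
      Filter.atTop (nhds (Literature.Probability.Percolation.theta (Literature.Probability.LatticeModels.zdGraph 3) 0
        (Literature.Probability.Percolation.criticalProbI 3) ^ 4)) := by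
    refine Filter.Tendsto.congr (fun r => ?_) h4
    simp [A4]
  have hlim2a : Filter.Tendsto (fun r : ℕ =>
      Literature.Probability.Percolation.tau 3 (Literature.Probability.Percolation.criticalProbI 3) 0 ![(r : ℤ), (r : ℤ), 0])
      Filter.atTop (nhds (Literature.Probability.Percolation.theta (Literature.Probability.LatticeModels.zdGraph 3) 0
        (Literature.Probability.Percolation.criticalProbI 3) ^ 2)) := by
    refine Filter.Tendsto.congr (fun r => ?_) h2a
    simp [A2, Literature.Probability.Percolation.tau_def]
  have hlim2b : Filter.Tendsto (fun r : ℕ =>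
      Literature.Probability.Percolation.tau 3 (Literature.Probability.Percolation.criticalProbI 3) ![(r : ℤ), 0, (r : ℤ)] ![0, (r : ℤ), (r : ℤ)])
      Filter.atTop (nhds (Literature.Probability.Percolation.theta (Literature.Probability.LatticeModels.zdGraph 3) 0
        (Literature.Probability.Percolation.criticalProbI 3) ^ 2)) := by
    refine Filter.Tendsto.congr (fun r => ?_) h2b
    simp [B2, Literature.Probability.Percolation.tau_def]
  -- pass to the limit in the strict Harris inequality
  obtain ⟨δ, hδ, r₀, hr⟩ := hH
  have hlimL := (hlim2a.const_mul (1 + δ)).mul hlim2b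
  have hle := le_of_tendsto_of_tendsto hlimL hlim4 (Filter.eventually_atTop.2 ⟨r₀, fun r hr' => hr r hr'⟩)
  have h4pos := pow_pos hθpos 4
  nlinarith [mul_pos hδ h4pos, hle, pow_succ (Literature.Probability.Percolation.theta
    (Literature.Probability.LatticeModels.zdGraph 3) 0 (Literature.Probability.Percolation.criticalProbI 3)) 2]

end Summit.CriticalPhenomena.PercolationContinuityZ3.Theses.PercTreeValue
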